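import Summits.QuantumAdvantage.AdviceFreeQNC0.NPGamma37SymFreeze
import HarnessLib

/-!
# Cell qa-qnc0 — (NP-Σ) part 3: THE ASSEMBLY `symLoss` over balanced base points and the theorems `ringHardSymFourier3` (e = 15, C = 8, n₀ = 200), `ringHardSymLinForms3` (e = 15, n₀ = 200).

Planner qa-qnc0-p2 gen 34 (INBOX P2-34h, memo HOME/qa-qnc0-p2/ROUND-34P2.md §4.9).  Part of the (NP-Σ) proof
`NPGamma37Sym` (statements, antipodal resonance, the BALANCED resonance MGF `resonance_windows_bal`/`resonance_poly_bal`) →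
`NPGamma37SymFreeze` (density of balanced base points `card_balAll`, the window transposition and FREEZING `wtX_U`, the class `PS`) →
`NPGamma37SymLoss` (the assembly `symLoss` and the theorems `ringHardSymFourier3`, `ringHardSymLinForms3`).
-/

noncomputable section

namespace Summit.QuantumAdvantage.AdviceFreeQNC0.NPGamma37Proof

open Finset F4
open Classical
open Summit.QuantumAdvantage.AdviceFreeQNC0.AffBells37 (exists_ne_one_of_mass_lt ev L sparse_ne_one two_pow_L_le)
open Summit.QuantumAdvantage.AdviceFreeQNC0.Resonance37G (orbit_mgf blockCpl blockCpl_involutive uExt_blockCpl xN xN_eq_xOfU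
  xN_blockCpl_of_ne xN_blockCpl_left xN_blockCpl_right Inv letter)

variable {F : ℕ}

section Sym

open Literature.Computability.QuantumComplexity Literature.Computability.QuantumComplexity.RingHLF
open Literature.Computability.MetaComplexity
open AffBells23 AffBells26
open Summit.QuantumAdvantage.AdviceFreeQNC0.NPGamma37 (InsulatedWindows)

variable {n : ℕ}
variable {N : ℕ}
variable {R : ℕ}

/-! ### 5. THE ASSEMBLY over balanced base points -/

/-- **THE SYMMETRIC SLICING THEOREM** (core form): under the hypotheses of `fourierLoss`, a strategy of the class `PS Q f`
wins at most `2ⁿ − 2ⁿ/(2·2^F·2^{L(K+1)})` odd inputs. -/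
theorem symLoss {p q : ℕ → ℕ} (hord : ∀ j < F, q j < p j ∧ p j + 1 < q (j + 1)) (hqF : q F < n) (hn : 4 ≤ n)
    (Q : Fin (n + 1) → Fin R → Smolensky.CubeFn (ZMod 3) (n + 1)) (f : Fin (n + 1) → ℕ → (Fin R → ZMod 3) → Bool)
    (hSA : ∀ (k : Fin R → ZMod 3) (g : Fin (n + 1)), SA (n := n) p F (QK Q k g))
    (hIA : ∀ (k : Fin R → ZMod 3) (g : Fin (n + 1)), IA p q F (QK Q k g))
    (h34N : 8 * 3 ^ R * (n + 1) * 3 ^ F ≤ 4 ^ F) (h2C : 4 * (n + 1) * (8 * F) ≤ 2 ^ F) :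
    (((univ.filter fun x : Fin (n + 1) → Bool => OddZeros x ∧ Rel x (zOf (PS Q f) x)).card : ℕ) : ℝ)
      ≤ (2 : ℝ) ^ n - (2 : ℝ) ^ n / (2 * (2 : ℝ) ^ F * (2 : ℝ) ^ L (Fintype.card (IxL n F R) + 1)) := by
  have hS : Sep n F p := sep_of_ord hord hqF
  haveI := F4.nontrivial
  -- wins and losses of the transported game
  set Los := univ.filter (fun u : Fin n → Bool => Wn (PS Q f) u = false) with hLos
  have hWL : (univ.filter fun u : Fin n → Bool => Wn (PS Q f) u = true).card + Los.card = 2 ^ n := by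
    have h := Finset.card_filter_add_card_filter_not (s := (univ : Finset (Fin n → Bool)))
      (fun u => Wn (PS Q f) u = true)
    rw [card_univ, Fintype.card_fun, Fintype.card_bool, Fintype.card_fin] at h
    rw [← h, hLos]
    congr 2
    exact filter_congr fun u _ => by cases Wn (PS Q f) u <;> simp
  have hS1 := S1 (by omega) (PS Q f)
  -- the balanced base points and the masses of their slices
  set K := Fintype.card (IxL n F R) with hK
  set massN : (Fin n → Bool) → ℕ := fun a => ∑ b : IxL n F R, 2 ^ (F - AffBells37.wt (rowsQ Q p a b)) with hmassN
  set A := univ.filter (fun a : Fin n → Bool => BalAll p F a) with hAdef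
  have hmemA : ∀ a, a ∈ A ↔ BalAll p F a := fun a => by rw [hAdef, mem_filter]; simp
  have hAcard : A.card * 2 ^ F = 2 ^ n := card_balAll hS
  set Good := A.filter (fun a : Fin n → Bool => massN a < 2 ^ F) with hGood
  set Bad := A.filter (fun a : Fin n → Bool => ¬ massN a < 2 ^ F) with hBad
  have hGB : Good.card + Bad.card = A.card := by
    rw [hGood, hBad, Finset.card_filter_add_card_filter_not]
  -- Step A: a good balanced slice loses `≥ 2^{F} / 2^{L(K+1)}` points (freezing + the (NP-ΓΛ) slice bound)
  set cnt : (Fin n → Bool) → ℕ := fun a =>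
    (univ.filter fun v : Fin F → Bool => Wn (PS Q f) (U p a v) = false).card with hcnt
  have hA : ∀ a ∈ Good, 2 ^ F ≤ 2 ^ L (K + 1) * cnt a := by
    intro a ha
    rw [hGood, mem_filter, hmemA] at ha
    have hex := exists_ne_one_of_mass_lt F univ (rowsQ Q p a) (coefsQ Q (fz f a) p a) ha.2
    have hsp := sparse_ne_one F univ (rowsQ Q p a) (coefsQ Q (fz f a) p a) hex
    rw [card_univ, ← hK, card_loss_sliceQ hS Q (fz f a) hSA a] at hsp
    have hcong : (univ.filter fun v : Fin F → Bool => Wn (PQ Q (fz f a)) (U p a v) = false)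
        = (univ.filter fun v : Fin F → Bool => Wn (PS Q f) (U p a v) = false) :=
      filter_congr fun v _ => by rw [Wn_congr (fun g => PQ_fz_eq_PS hS Q f a ha.1 v g)]
    rw [hcong] at hsp
    exact hsp
  -- Step B: summing over good slices and re-randomising: `#Good ≤ 2^{L(K+1)} · #Los`
  have hsumcnt : ∑ a : Fin n → Bool, cnt a = 2 ^ F * Los.card := by
    have h1 : ∀ a, cnt a = ∑ v : Fin F → Bool, (if Wn (PS Q f) (U p a v) = false then 1 else 0) := by
      intro a; rw [hcnt]; exact card_filter _ _
    simp_rw [h1]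
    rw [sum_comm, sum_sum_U p (fun u => if Wn (PS Q f) u = false then 1 else 0), hLos, card_filter]
  have hB : Good.card ≤ 2 ^ L (K + 1) * Los.card := by
    have h1 : Good.card * 2 ^ F ≤ 2 ^ L (K + 1) * (2 ^ F * Los.card) := by
      calc Good.card * 2 ^ F = ∑ a ∈ Good, 2 ^ F := by rw [sum_const, smul_eq_mul]
        _ ≤ ∑ a ∈ Good, 2 ^ L (K + 1) * cnt a := sum_le_sum hA
        _ ≤ ∑ a, 2 ^ L (K + 1) * cnt a :=
            sum_le_sum_of_subset_of_nonneg (subset_univ _) fun _ _ _ => Nat.zero_le _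
        _ = 2 ^ L (K + 1) * (2 ^ F * Los.card) := by rw [← mul_sum, hsumcnt]
    have hpos : 0 < 2 ^ F := by positivity
    rw [show 2 ^ L (K + 1) * (2 ^ F * Los.card) = (2 ^ L (K + 1) * Los.card) * 2 ^ F by ring] at h1
    exact Nat.le_of_mul_le_mul_right h1 hpos
  -- Step C: bad balanced slices are rare (mass bookkeeping + the BALANCED resonance MGF + Markov)
  set C : ℕ := 2 * (n + 1) * (8 * F) with hC
  set T : (Fin n → Bool) → ℝ := fun a => ∑ g : Fin (n + 1), ∑ σ : Bool, ∑ k : Fin R → ZMod 3,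
      (2 : ℝ) ^ Zcount (F := F) (QK Q k) p a g (σv σ) 1 with hT
  set T' : (Fin n → Bool) → ℝ := fun a => ∑ g : Fin (n + 1), ∑ σ : Bool, ∑ k : Fin R → ZMod 3,
      (if BalAll p F a then (2 : ℝ) ^ Zcount (F := F) (QK Q k) p a g (σv σ) 1 else 0) with hT'
  have hTT' : ∀ a ∈ A, T a = T' a := by
    intro a ha
    rw [hmemA] at ha
    simp only [hT, hT', if_pos ha]
  have hT'nn : ∀ a, 0 ≤ T' a := by
    intro a; rw [hT']
    exact sum_nonneg fun g _ => sum_nonneg fun σ _ => sum_nonneg fun k _ => by split_ifs <;> positivity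
  have hmass : ∀ a, (massN a : ℝ) ≤ C + T a := by
    intro a
    have h := mass_rows_leQ (F := F) Q p a
    have h' : ((massN a : ℕ) : ℝ) ≤ ((2 * (n + 1) * (8 * F) +
        ∑ g : Fin (n + 1), ∑ σ : Bool, ∑ k : Fin R → ZMod 3,
          2 ^ Zcount (F := F) (QK Q k) p a g (σv σ) 1 : ℕ) : ℝ) := by
      exact_mod_cast h
    have hC' : (C : ℝ) = 2 * ((n : ℝ) + 1) * (8 * (F : ℝ)) := by rw [hC]; push_cast; ring
    have hT1 : T a = ∑ g : Fin (n + 1), ∑ σ : Bool, ∑ k : Fin R → ZMod 3,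
        (2 : ℝ) ^ Zcount (F := F) (QK Q k) p a g (σv σ) 1 := rfl
    rw [hC', hT1]
    push_cast at h'
    linarith
  have h3R : (Fintype.card (Fin R → ZMod 3) : ℝ) = (3 : ℝ) ^ R := by
    rw [Fintype.card_fun, ZMod.card, Fintype.card_fin]; push_cast; ring
  set M : ℝ := (2 : ℝ) ^ n / (2 : ℝ) ^ F with hM
  have h2F : (0 : ℝ) < (2 : ℝ) ^ F := by positivity
  have hM34 : (2 : ℝ) ^ n * (3 / 4 : ℝ) ^ F = M * (3 / 2 : ℝ) ^ F := by
    rw [hM, div_mul_eq_mul_div, eq_div_iff h2F.ne', mul_assoc, ← mul_pow]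
    norm_num
  have hAcardR : (A.card : ℝ) = M := by
    rw [hM, eq_div_iff h2F.ne']
    exact_mod_cast hAcard
  have hT'sum : ∑ a : Fin n → Bool, T' a ≤ 2 * (3 : ℝ) ^ R * (n + 1) * (M * (3 / 2 : ℝ) ^ F) := by
    rw [← hM34, hT', sum_comm]
    have hg : ∀ g : Fin (n + 1), ∑ a : Fin n → Bool, ∑ σ : Bool, ∑ k : Fin R → ZMod 3,
        (if BalAll p F a then (2 : ℝ) ^ Zcount (F := F) (QK Q k) p a g (σv σ) 1 else 0)
          ≤ 2 * (3 : ℝ) ^ R * ((2 : ℝ) ^ n * (3 / 4 : ℝ) ^ F) := by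
      intro g
      rw [sum_comm]
      have hσ : ∀ σ : Bool, ∑ a : Fin n → Bool, ∑ k : Fin R → ZMod 3,
          (if BalAll p F a then (2 : ℝ) ^ Zcount (F := F) (QK Q k) p a g (σv σ) 1 else 0)
            ≤ (3 : ℝ) ^ R * ((2 : ℝ) ^ n * (3 / 4 : ℝ) ^ F) := by
        intro σ
        rw [sum_comm]
        have hk : ∀ k : Fin R → ZMod 3, ∑ a : Fin n → Bool,
            (if BalAll p F a then (2 : ℝ) ^ Zcount (F := F) (QK Q k) p a g (σv σ) 1 else 0)
              ≤ (2 : ℝ) ^ n * (3 / 4 : ℝ) ^ F :=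
          fun k => resonance_poly_bal hord hqF (QK Q k) (hIA k) g (σv σ) 1 (σv_ne_zero σ)
        calc _ ≤ ∑ _k : Fin R → ZMod 3, (2 : ℝ) ^ n * (3 / 4 : ℝ) ^ F := sum_le_sum fun k _ => hk k
          _ = (3 : ℝ) ^ R * ((2 : ℝ) ^ n * (3 / 4 : ℝ) ^ F) := by rw [sum_const, card_univ, nsmul_eq_mul, h3R]
      calc _ ≤ ∑ σ : Bool, (3 : ℝ) ^ R * ((2 : ℝ) ^ n * (3 / 4 : ℝ) ^ F) := sum_le_sum fun σ _ => hσ σ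
        _ = _ := by rw [Fintype.sum_bool]; ring
    calc _ ≤ ∑ g : Fin (n + 1), 2 * (3 : ℝ) ^ R * ((2 : ℝ) ^ n * (3 / 4 : ℝ) ^ F) := sum_le_sum fun g _ => hg g
      _ = _ := by rw [sum_const, card_univ, Fintype.card_fin]; ring
  have hBadR : (Bad.card : ℝ) * ((2 : ℝ) ^ F - C) ≤ 2 * (3 : ℝ) ^ R * (n + 1) * (M * (3 / 2 : ℝ) ^ F) := by
    have h1 : ∀ a ∈ Bad, ((2 : ℝ) ^ F - C) ≤ T a := by
      intro a ha
      rw [hBad, mem_filter, not_lt] at ha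
      have h2 : ((2 ^ F : ℕ) : ℝ) ≤ (massN a : ℝ) := by exact_mod_cast ha.2
      push_cast at h2
      linarith [hmass a]
    have hBadA : Bad ⊆ A := by rw [hBad]; exact filter_subset _ _
    calc (Bad.card : ℝ) * ((2 : ℝ) ^ F - C) = ∑ a ∈ Bad, ((2 : ℝ) ^ F - C) := by
          rw [sum_const, nsmul_eq_mul]
      _ ≤ ∑ a ∈ Bad, T a := sum_le_sum h1
      _ = ∑ a ∈ Bad, T' a := sum_congr rfl fun a ha => hTT' a (hBadA ha)
      _ ≤ ∑ a, T' a := sum_le_sum_of_subset_of_nonneg (subset_univ _) fun a _ _ => hT'nn a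
      _ ≤ _ := hT'sum
  -- Step D: the numbers
  have hC2 : 2 * (C : ℝ) ≤ (2 : ℝ) ^ F := by
    have h : 2 * C ≤ 2 ^ F := by
      calc 2 * C = 4 * (n + 1) * (8 * F) := by rw [hC]; ring
        _ ≤ 2 ^ F := h2C
    exact_mod_cast h
  have h34 : 8 * (3 : ℝ) ^ R * ((n : ℝ) + 1) * (3 : ℝ) ^ F ≤ (4 : ℝ) ^ F := by exact_mod_cast h34N
  have hMnn : (0 : ℝ) ≤ M := by rw [hM]; positivity
  have hBadle : (Bad.card : ℝ) ≤ M / 2 := by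
    have hCnn : (0 : ℝ) ≤ C := by positivity
    have h1 : (Bad.card : ℝ) * ((2 : ℝ) ^ F / 2) ≤ 2 * (3 : ℝ) ^ R * (n + 1) * (M * (3 / 2 : ℝ) ^ F) := by
      have hb : (0 : ℝ) ≤ Bad.card := by positivity
      calc (Bad.card : ℝ) * ((2 : ℝ) ^ F / 2) ≤ (Bad.card : ℝ) * ((2 : ℝ) ^ F - C) :=
            mul_le_mul_of_nonneg_left (by linarith) hb
        _ ≤ _ := hBadR
    have h32 : (3 / 2 : ℝ) ^ F * (2 : ℝ) ^ F = (3 : ℝ) ^ F := by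
      rw [← mul_pow]; norm_num
    have h42 : (4 : ℝ) ^ F = (2 : ℝ) ^ F * (2 : ℝ) ^ F := by
      rw [← mul_pow]; norm_num
    have key : (8 * (3 : ℝ) ^ R * ((n : ℝ) + 1) * (3 / 2 : ℝ) ^ F) * (2 : ℝ) ^ F ≤ (2 : ℝ) ^ F * (2 : ℝ) ^ F := by
      calc (8 * (3 : ℝ) ^ R * ((n : ℝ) + 1) * (3 / 2 : ℝ) ^ F) * (2 : ℝ) ^ F
          = 8 * (3 : ℝ) ^ R * ((n : ℝ) + 1) * ((3 / 2 : ℝ) ^ F * (2 : ℝ) ^ F) := by ring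
        _ = 8 * (3 : ℝ) ^ R * ((n : ℝ) + 1) * (3 : ℝ) ^ F := by rw [h32]
        _ ≤ (4 : ℝ) ^ F := h34
        _ = (2 : ℝ) ^ F * (2 : ℝ) ^ F := h42
    have h34' : 8 * (3 : ℝ) ^ R * ((n : ℝ) + 1) * (3 / 2 : ℝ) ^ F ≤ (2 : ℝ) ^ F := le_of_mul_le_mul_right key h2F
    have h2 : (Bad.card : ℝ) * ((2 : ℝ) ^ F / 2) ≤ (M / 2) * ((2 : ℝ) ^ F / 2) :=
      h1.trans (by
        calc 2 * (3 : ℝ) ^ R * ((n : ℝ) + 1) * (M * (3 / 2 : ℝ) ^ F)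
            = (M / 4) * (8 * (3 : ℝ) ^ R * ((n : ℝ) + 1) * (3 / 2 : ℝ) ^ F) := by ring
          _ ≤ (M / 4) * (2 : ℝ) ^ F := mul_le_mul_of_nonneg_left h34' (by positivity)
          _ = (M / 2) * ((2 : ℝ) ^ F / 2) := by ring)
    exact le_of_mul_le_mul_right h2 (by positivity)
  -- Step E: conclude
  have hGoodR : M / 2 ≤ Good.card := by
    have h : ((Good.card + Bad.card : ℕ) : ℝ) = M := by rw [hGB]; exact hAcardR
    push_cast at h
    linarith
  have hLosR : M / 2 ≤ (2 : ℝ) ^ L (K + 1) * Los.card := by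
    have h : (Good.card : ℝ) ≤ ((2 ^ L (K + 1) * Los.card : ℕ) : ℝ) := by exact_mod_cast hB
    push_cast at h
    linarith
  have hWR : ((univ.filter fun u : Fin n → Bool => Wn (PS Q f) u = true).card : ℝ) = (2 : ℝ) ^ n - Los.card := by
    have h : (((univ.filter fun u : Fin n → Bool => Wn (PS Q f) u = true).card + Los.card : ℕ) : ℝ)
        = (2 : ℝ) ^ n := by
      rw [hWL]; push_cast; ring
    push_cast at h
    linarith
  have hpowL : (0 : ℝ) < (2 : ℝ) ^ L (K + 1) := by positivity
  have hML : M / (2 * (2 : ℝ) ^ L (K + 1)) = (2 : ℝ) ^ n / (2 * (2 : ℝ) ^ F * (2 : ℝ) ^ L (K + 1)) := by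
    rw [hM, div_div]
    congr 1
    ring
  calc (((univ.filter fun x : Fin (n + 1) → Bool => OddZeros x ∧ Rel x (zOf (PS Q f) x)).card : ℕ) : ℝ)
      ≤ ((univ.filter fun u : Fin n → Bool => Wn (PS Q f) u = true).card : ℝ) := by exact_mod_cast hS1
    _ = (2 : ℝ) ^ n - Los.card := hWR
    _ ≤ (2 : ℝ) ^ n - M / (2 * (2 : ℝ) ^ L (K + 1)) := by
        have : M / (2 * (2 : ℝ) ^ L (K + 1)) ≤ Los.card := by
          rw [div_le_iff₀ (by positivity)]
          calc M = 2 * (M / 2) := by ring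
            _ ≤ 2 * ((2 : ℝ) ^ L (K + 1) * Los.card) := by linarith
            _ = (Los.card : ℝ) * (2 * (2 : ℝ) ^ L (K + 1)) := by ring
        linarith
    _ = (2 : ℝ) ^ n - (2 : ℝ) ^ n / (2 * (2 : ℝ) ^ F * (2 : ℝ) ^ L (K + 1)) := by rw [hML]

/-! ### 6. The numerics and THE THEOREMS -/

/-- `2 · 2^F · 2^{L(K+1)} ≤ (n+1)^{15}` for `F = 8 log₂(n+1)`, `n + 1 ≥ 200`, `R ≤ log₂(n+1)`. -/
theorem numericsS (hN : 200 ≤ n + 1) (hR : R ≤ Nat.log 2 (n + 1)) :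
    2 * 2 ^ (8 * Nat.log 2 (n + 1)) * 2 ^ L ((n + 1) * (2 * (3 ^ R + 4 * (8 * Nat.log 2 (n + 1)))) + 1)
      ≤ (n + 1) ^ 15 := by
  obtain ⟨-, -, hK, -⟩ := numericsΛ (R := R) hN hR
  have h2k : 2 ^ Nat.log 2 (n + 1) ≤ n + 1 := Nat.pow_log_le_self 2 (by omega)
  have h8 : 2 ^ (8 * Nat.log 2 (n + 1)) ≤ (n + 1) ^ 8 := by
    rw [mul_comm, pow_mul]
    exact Nat.pow_le_pow_left h2k 8
  calc 2 * 2 ^ (8 * Nat.log 2 (n + 1)) * 2 ^ L ((n + 1) * (2 * (3 ^ R + 4 * (8 * Nat.log 2 (n + 1)))) + 1)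
      = 2 ^ (8 * Nat.log 2 (n + 1)) *
          (2 * 2 ^ L ((n + 1) * (2 * (3 ^ R + 4 * (8 * Nat.log 2 (n + 1)))) + 1)) := by ring
    _ ≤ (n + 1) ^ 8 * (n + 1) ^ 7 := Nat.mul_le_mul h8 hK
    _ = (n + 1) ^ 15 := by ring

/-- **(NP-Σ), explicit constants**: `e = 15`, `C = 8`, `n₀ = 200`, `R ≤ log₂ n` polynomials per output plus `|x|`. -/
theorem ringHardSymFourier3_explicit : ∀ N ≥ 200, ∀ 𝓢 : Set (Finset (Fin N)),
    InsulatedWindows 𝓢 (8 * Nat.log 2 N) →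
    ∀ R ≤ Nat.log 2 N, ∀ Q : Fin N → Fin R → Smolensky.CubeFn (ZMod 3) N,
      (∀ g i, Q g i ∈ Submodule.span (ZMod 3) (Smolensky.mono (ZMod 3) '' 𝓢)) →
      ∀ f : Fin N → ℕ → (Fin R → ZMod 3) → Bool,
        ((univ.filter fun x : Fin N → Bool =>
            OddZeros x ∧ RingHLF.Rel x (fun g => f g (wtX x) (fun i => Q g i x))).card : ℝ)
          ≤ (1 - 1 / (N : ℝ) ^ 15) * (2 : ℝ) ^ (N - 1) := by
  intro N hN 𝓢 hW R hR Q hQ f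
  obtain ⟨n, rfl⟩ : ∃ n, N = n + 1 := ⟨N - 1, by omega⟩
  obtain ⟨p, q, _, hqF3, hord, h4, h5⟩ := hW
  obtain ⟨h1, h2⟩ := H1'_H2'_of_insulated h4 h5
  have hqF : q (8 * Nat.log 2 (n + 1)) < n := by omega
  have hS := sep_of_ord hord hqF
  have hSAIA := SAIA_of_span hS h1 h2 Q hQ
  obtain ⟨h34N, h2C, -, -⟩ := numericsΛ (R := R) hN hR
  have hD := numericsS (R := R) hN hR
  have hmain := symLoss hord hqF (by omega) Q f (fun k g => (hSAIA k g).1) (fun k g => (hSAIA k g).2) h34N h2C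
  rw [card_IxL] at hmain
  have hflt : (univ.filter fun x : Fin (n + 1) → Bool =>
        OddZeros x ∧ RingHLF.Rel x (fun g => f g (wtX x) (fun i => Q g i x)))
      = (univ.filter fun x : Fin (n + 1) → Bool => OddZeros x ∧ Rel x (zOf (PS Q f) x)) :=
    filter_congr fun x _ => by rw [zOf_PS]; exact Iff.rfl
  rw [hflt, show n + 1 - 1 = n from rfl]
  push_cast
  have hDR : 2 * (2 : ℝ) ^ (8 * Nat.log 2 (n + 1)) *
      (2 : ℝ) ^ L ((n + 1) * (2 * (3 ^ R + 4 * (8 * Nat.log 2 (n + 1)))) + 1) ≤ ((n : ℝ) + 1) ^ 15 := by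
    exact_mod_cast hD
  exact law_of_lossD (by positivity) hmain hDR

/-- **(NP-Σ) PROVED**: `RingHardSymFourier3` with `e = 15`, `C = 8`, `n₀ = 200`. -/
theorem ringHardSymFourier3 : RingHardSymFourier3 := ⟨15, 8, 200, ringHardSymFourier3_explicit⟩

/-- **(NP-ΣΛ), explicit constants**: `e = 15`, `n₀ = 200`: outputs `f_g(|x|, ≤ log₂ n linear forms)`; windows `p_j = 3j+3`,
insulators `q_i = 3i+2`. -/
theorem ringHardSymLinForms3_explicit : ∀ N ≥ 200, ∀ R ≤ Nat.log 2 N, ∀ Lf : Fin N → Fin R → Fin N → ZMod 3,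
    ∀ f : Fin N → ℕ → (Fin R → ZMod 3) → Bool,
      ((univ.filter fun x : Fin N → Bool =>
          OddZeros x ∧ RingHLF.Rel x
            (fun g => f g (wtX x) (fun i => ∑ m : Fin N, if x m then Lf g i m else 0))).card : ℝ)
        ≤ (1 - 1 / (N : ℝ) ^ 15) * (2 : ℝ) ^ (N - 1) := by
  intro N hN R hR Lf f
  obtain ⟨n, rfl⟩ : ∃ n, N = n + 1 := ⟨N - 1, by omega⟩
  obtain ⟨h34N, h2C, -, h24⟩ := numericsΛ (R := R) hN hR
  have hD := numericsS (R := R) hN hR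
  have hord : ∀ j < 8 * Nat.log 2 (n + 1), (fun i => 3 * i + 2) j < (fun j => 3 * j + 3) j ∧
      (fun j => 3 * j + 3) j + 1 < (fun i => 3 * i + 2) (j + 1) := by
    intro j _; simp only; omega
  have hqF : (fun i => 3 * i + 2) (8 * Nat.log 2 (n + 1)) < n := by simp only; omega
  have hS := sep_of_ord hord hqF
  set Q : Fin (n + 1) → Fin R → Smolensky.CubeFn (ZMod 3) (n + 1) := fun g i => LinF (Lf g i) with hQdef
  have hQ : ∀ g i, Q g i ∈ Submodule.span (ZMod 3) (Smolensky.mono (ZMod 3) '' Sing (n + 1)) :=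
    fun g i => LinF_mem_span (Lf g i)
  have hSAIA := SAIA_of_span hS (H1'_sing hS) (H2'_sing hord) Q hQ
  have hmain := symLoss hord hqF (by omega) Q f (fun k g => (hSAIA k g).1) (fun k g => (hSAIA k g).2) h34N h2C
  rw [card_IxL] at hmain
  have hflt : (univ.filter fun x : Fin (n + 1) → Bool =>
        OddZeros x ∧ RingHLF.Rel x
          (fun g => f g (wtX x) (fun i => ∑ m : Fin (n + 1), if x m then Lf g i m else 0)))
      = (univ.filter fun x : Fin (n + 1) → Bool => OddZeros x ∧ Rel x (zOf (PS Q f) x)) :=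
    filter_congr fun x _ => by rw [zOf_PS]; exact Iff.rfl
  rw [hflt, show n + 1 - 1 = n from rfl]
  push_cast
  have hDR : 2 * (2 : ℝ) ^ (8 * Nat.log 2 (n + 1)) *
      (2 : ℝ) ^ L ((n + 1) * (2 * (3 ^ R + 4 * (8 * Nat.log 2 (n + 1)))) + 1) ≤ ((n : ℝ) + 1) ^ 15 := by
    exact_mod_cast hD
  exact law_of_lossD (by positivity) hmain hDR

/-- **(NP-ΣΛ) PROVED**: `RingHardSymLinForms3` with `e = 15`, `n₀ = 200`. -/
theorem ringHardSymLinForms3 : RingHardSymLinForms3 := ⟨15, 200, ringHardSymLinForms3_explicit⟩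

end Sym

end Summit.QuantumAdvantage.AdviceFreeQNC0.NPGamma37Proof
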